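import Literature.AlgebraicGeometry.GroupSchemes.UnitComponentSpecialFibreStalk
import Literature.AlgebraicGeometry.GroupSchemes.UnitComponentTowerSpecialFibre
import HarnessLib

/-!
# The θ-datum of the special fibre of the unit-component tower of a Barsotti–Tate group ([Tate1967] §2.2, (2.4))

Topic `Literature/AlgebraicGeometry/GroupSchemes`; namespace `Literature.AlgebraicGeometry.GroupSchemes.BTGroup`. THEOREMS ONLY
(one theorem; no definition, no named fact, no instance, no `sorry`). Sequel of ★ `UnitComponentTowerSpecialFibre` (the k-side:
the special-fibre layers `B₀[pⁿ] ×_{A⧸J} κ(A)` as kernel presentations of `[pⁿ]` on the closed fibre, their stalks at the unit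
point `≅ 𝒪_{𝒜,e} ⧸ [pⁿ]^♯ 𝔪_e` via ★ `AbelianVarietyTorsionStalkQuotient`, and the assembly `exists_theta_of_sigma`) and of ★
`UnitComponentSpecialFibreStalk` (the A-side: `Γ(G₀ n) ⧸ 𝔪·Γ(G₀ n) ≅` the stalk of the special fibre at the unit point, for a
connected clopen affine subgroup `G₀ n ↪ B[pⁿ]`, `exists_specialFibre_stalk_tower`). The single theorem here composes them:

* `exists_theta_specialFibre_unitComponentTower` — for the unit-component sub-tower `jG n : G₀ n ↪ B[pⁿ]` of a Barsotti–Tate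
  group `B` over an Artinian local `A` (★ `exists_unitComponentTower`) whose reduction `B₀ = B ×_A (A⧸J)` is the `p`-divisible
  group of an abelian scheme `X₀` (a torsion tower `i₀`), the special fibres `Γ(G₀ n) ⧸ 𝔪·Γ(G₀ n)` are the quotients
  `𝒪_{𝒜,e} ⧸ [pⁿ]^♯ 𝔪_e · 𝒪_{𝒜,e}` of the local ring at the origin of the closed fibre `𝒜 = X₀ ×_{A⧸J} κ(A)`, compatibly with the
  sub-tower maps and the structure maps — the θ-datum `θ hθρ hθc` consumed by ★ `PowerSeriesTower.exists_specialFibre_transport`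
  (and thence by the power-series presentation of the unit-component algebras, ★ `PowerSeriesTowerPresentation`).

References: [Tate1967] J. T. Tate, *p-divisible groups*, Proc. Conf. Local Fields (Driebergen 1966), §2.2 (proof of Prop. 1), (2.4);
[GortzWedhorn2023] U. Görtz, T. Wedhorn, *Algebraic Geometry II*, Prop. 27.186 (p. 674).
-/

noncomputable section

set_option backward.isDefEq.respectTransparency false

open CategoryTheory CategoryTheory.Limits AlgebraicGeometry MonoidalCategory CartesianMonoidalCategory IsLocalRing
open scoped MonObj CategoryTheory.Obj

namespace Literature.AlgebraicGeometry.GroupSchemes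

namespace BTGroup

open Literature.AlgebraicGeometry.AbelianSchemes Literature.AlgebraicGeometry.AbelianSchemes.AbelianSchemeOver
open Literature.AlgebraicGeometry.Motives Literature.AlgebraicGeometry.Motives.AbelianVariety

/-- **THE θ-DATUM OF THE SPECIAL FIBRE OF THE UNIT-COMPONENT TOWER** ([Tate1967] §2.2 «one is reduced to the case R = k»,
for the connected part (2.4)). Let `A` be Artinian local with `(p : κ(A)) = 0`, `J ≠ ⊤`, `X₀ → Spec (A⧸J)` an abelian scheme,
`B₀` a Barsotti–Tate group over `Spec (A⧸J)` with a torsion tower `i₀ n : B₀[pⁿ] → X₀` (homomorphisms, kernel squares of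
`[pⁿ]`, compatible with the transitions), `B` a Barsotti–Tate group over `Spec A` with `B₀ = B ×_A (A⧸J)` (`c`), and
`jG n : G₀ n ↪ B[pⁿ]` its unit-component sub-tower (homomorphic open immersions with connected affine finite sources, sub-tower
maps `incl₀` over the transitions — ★ `exists_unitComponentTower`). Then the special fibres `Γ(G₀ n) ⧸ 𝔪·Γ(G₀ n)` of the
unit-component algebras are, compatibly with `incl₀` and with the structure maps, the quotients `𝒪_{𝒜,e} ⧸ [pⁿ]^♯ 𝔪_e · 𝒪_{𝒜,e}`
of the local ring at the origin of the closed fibre `𝒜 = X₀ ×_{A⧸J} κ(A)` — the θ-datum `θ hθρ hθc` of ★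
`PowerSeriesTower.exists_specialFibre_transport` (★ `exists_specialFibre_stalk_tower` ∘ `exists_theta_of_sigma`).
[cite: Tate1967, §2.2 (proof of Prop. 1) and (2.4)] [cite: GortzWedhorn2023, Prop. 27.186 (p. 674)] -/
theorem exists_theta_specialFibre_unitComponentTower {A : Type} [CommRing A] [IsArtinianRing A] [IsLocalRing A]
    {p : ℕ} (hp0 : ((p : ℕ) : IsLocalRing.ResidueField A) = 0) {J : Ideal A} (hJ : J ≠ ⊤) {h₀ : ℕ}
    (X₀ : AbelianSchemeOver (Spec (.of (A ⧸ J)))) (B₀ : BTGroup (Spec (.of (A ⧸ J))) p h₀) (i₀ : ∀ n, B₀.G n ⟶ X₀.X)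
    (hi₀hom : ∀ n, letI := B₀.grpObj n; IsMonHom (i₀ n))
    (hi₀sq : ∀ n, IsPullback (i₀ n) (toUnit (B₀.G n)) ((𝟙 X₀.X : X₀.X ⟶ X₀.X) ^ (p ^ n)) η[X₀.X])
    (hi₀incl : ∀ n, B₀.incl n ≫ i₀ (n + 1) = i₀ n)
    (B : BTGroup (Spec (.of A)) p h₀) (c : ∀ n, (B₀.G n).left ⟶ (B.G n).left)
    (hBc : B₀.IsBaseChangeVia B (Spec.map (CommRingCat.ofHom (Ideal.Quotient.mk J))) c)
    (G₀ : ℕ → Over (Spec (.of A))) (hG₀ : ∀ n, GrpObj (G₀ n)) (jG : ∀ n, G₀ n ⟶ B.G n)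
    (incl₀ : ∀ ⦃n m : ℕ⦄, n ≤ m → ((G₀ n).left ⟶ (G₀ m).left))
    (hjhom : ∀ n, letI := B.grpObj n; IsMonHom (jG n)) (hjo : ∀ n, IsOpenImmersion (jG n).left)
    (hconn : ∀ n, ConnectedSpace ↥(G₀ n).left) (haff : ∀ n, IsAffine (G₀ n).left) (hfin : ∀ n, IsFinite (G₀ n).hom)
    (hιj : ∀ (n m : ℕ) (h : n ≤ m), incl₀ h ≫ (jG m).left = (jG n).left ≫ (B.transition h).left) :
    ∃ θ : ∀ n, (Γ((G₀ n).left, ⊤) ⧸ (maximalIdeal A).map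
          (((G₀ n).hom.appTop).hom.comp (Scheme.ΓSpecIso (.of A)).inv.hom)) ≃+*
        (↥(stalkOrigin (AbelianSchemeOver.closedFibre hJ X₀).toAffine.toAbelianVariety) ⧸
          (maximalIdeal (stalkOrigin (AbelianSchemeOver.closedFibre hJ X₀).toAffine.toAbelianVariety)).map
            (stalkMapEnd (AbelianSchemeOver.closedFibre hJ X₀).toAffine.toAbelianVariety
              (((p ^ n : ℕ) : ℤ) • 𝟙 (AbelianSchemeOver.closedFibre hJ X₀).toAffine.toAbelianVariety)).hom),
      (∀ ⦃n m : ℕ⦄ (h : n ≤ m) (x : Γ((G₀ m).left, ⊤)),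
        θ n (Ideal.Quotient.mk _ (((incl₀ h).appTop).hom x)) =
          Ideal.Quotient.factor
            ((AbelianSchemeOver.closedFibre hJ X₀).toAffine.toAbelianVariety.antitone_torsionStalkIdeal hp0 h)
            (θ m (Ideal.Quotient.mk _ x))) ∧
      (∀ n (a : A), θ n (Ideal.Quotient.mk _
          ((((G₀ n).hom.appTop).hom.comp (Scheme.ΓSpecIso (.of A)).inv.hom) a)) =
        Ideal.Quotient.mk _
          (stalkOriginAlgebraMap (AbelianSchemeOver.closedFibre hJ X₀).toAffine.toAbelianVariety
            (IsLocalRing.residue A a))) := by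
  letI : ∀ n, GrpObj (B.G n) := fun n => B.grpObj n
  letI := hG₀
  haveI := haff; haveI := hfin; haveI := hconn
  have hσ := exists_specialFibre_stalk_tower (G := B.G) (fun _ _ h => B.transition h) G₀ jG hjhom hjo incl₀ hιj
    (fun n => ((Over.pullback (residueBaseMap hJ)).obj (B₀.G n)).left)
    (fun n => pullback.fst (B₀.G n).hom (residueBaseMap hJ) ≫ c n)
    (fun n => ((Over.pullback (residueBaseMap hJ)).obj (B₀.G n)).hom)
    (fun n => isPullback_fst_comp_of_isBaseChangeVia hJ B₀ B hBc n)
    (fun _ _ h => ((Over.pullback (residueBaseMap hJ)).map (B₀.transition h)).left)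
    (fun n m h => pullback_map_transition_left_comp_fst_comp hJ B₀ B hBc h)
    (fun n => letI := B₀.grpObj n
      (((η[(Over.pullback (residueBaseMap hJ)).obj (B₀.G n)]).left : Spec (.of (IsLocalRing.ResidueField A)) ⟶ _).base
        (IsLocalRing.closedPoint (IsLocalRing.ResidueField A))))
    (fun n => fst_comp_base_unit_eq_unit hJ B₀ B hBc n)
    (fun n m h => pullback_map_transition_base_unit hJ B₀ h)
  exact exists_theta_of_sigma hJ X₀ B₀ i₀ hp0 hi₀hom hi₀sq hi₀incl G₀ incl₀ hσ

end BTGroup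

end Literature.AlgebraicGeometry.GroupSchemes

end
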